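import Literature.Algebra.Semigroups.CyclicSemigroups
import Literature.Algebra.Semigroups.GreenGroupHClasses

/-!
# Green's relations and conjugacy in finite semigroups

[Ganyushkin–Mazorchuk 2009, §5.4.2 (Theorem 5.4.1) and §6.4 (Proposition 6.4.6 –
Corollary 6.4.11)], for a finite monoid `M` (the book's `S¹`).  Green's relations are spelled
out as in `GreensLemma`: `a 𝓛 b` iff `a ∈ M b` and `b ∈ M a`, etc.; `a 𝓓 b` iff
`a 𝓛 c 𝓡 b` for some `c`; `a 𝓙 b` iff `a ∈ M b M` and `b ∈ M a M`.

* Theorem 5.4.1: in a finite semigroup `𝓓 = 𝓙` (`greenD_of_greenJ`, `greenD_iff_greenJ`), through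
  the stability facts of its proof: if `a = x(uav)y` then `a 𝓛 ua` and `a 𝓡 av`
  (`greenL_mul_of_eq`, `greenR_mul_of_eq`);
* §6.4: primary `S`-conjugacy `x ∼ₚ y` (`x = ab`, `y = ba` for some `a, b`):
  Proposition 6.4.6 (`pow_primConj_pow`, `primConj_of_pow_idempotent`), Lemma 6.4.7 and
  Corollary 6.4.8 (on idempotents `∼ₚ` is an equivalence relation: `primConj_idempotent_refl`,
  `primConj_symm`, `primConj_idempotent_trans`), Corollary 6.4.11 (for idempotents of a finite
  semigroup, `e ∼ₚ f ↔ e 𝓓 f`: `primConj_idempotent_iff_greenD`).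

## References
* [GanyushkinMazorchuk2009] O. Ganyushkin, V. Mazorchuk, *Classical Finite Transformation
  Semigroups. An Introduction*, Algebra and Applications 9, Springer, 2009, §5.4, §6.4.
-/

namespace Literature.Algebra.Semigroups

variable {M : Type*} [Monoid M]

/-! ### Theorem 5.4.1: `𝓓 = 𝓙` in finite semigroups -/

/-- If `e` is an idempotent and `a = e a q` then `e a = a`. [folklore] -/
private theorem idempotent_mul_eq_of_eq {e a q : M} (he : IsIdempotentElem e) (h : a = e * a * q) :
    e * a = a := by
  rw [h, ← mul_assoc, ← mul_assoc, he.eq]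

/-- The key step of the proof of Theorem 5.4.1 (finite `M`): if `a = x (u a v) y` then
`a 𝓛 ua`.  Indeed `a = (xu)ᵏ a (vy)ᵏ` for all `k`; with `(xu)ᵏ = e` idempotent, `ea = a`, so
`a = (xu)ᵏ⁻¹x · ua`. [cite: GanyushkinMazorchuk2009, Theorem 5.4.1 (proof)] -/
theorem greenL_mul_of_eq [Finite M] {a x u v y : M} (h : a = x * (u * a * v) * y) :
    (∃ p, a = p * (u * a)) ∧ ∃ q, u * a = q * a := by
  refine ⟨?_, ⟨u, rfl⟩⟩
  have h1 : ∀ k : ℕ, a = (x * u) ^ k * a * (v * y) ^ k := by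
    intro k
    induction k with
    | zero => simp
    | succ k ih =>
      calc a = x * (u * a * v) * y := h
        _ = x * (u * ((x * u) ^ k * a * (v * y) ^ k) * v) * y := by rw [← ih]
        _ = (x * u) ^ (k + 1) * a * (v * y) ^ (k + 1) := by
          rw [pow_succ', pow_succ]; simp only [mul_assoc]
  obtain ⟨n, hn, he⟩ := exists_isIdempotentElem_pow (x * u)
  have hea : (x * u) ^ n * a = a := idempotent_mul_eq_of_eq he (h1 n)
  obtain ⟨m, rfl⟩ := Nat.exists_eq_add_of_le hn
  refine ⟨(x * u) ^ m * x, ?_⟩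
  calc a = (x * u) ^ (1 + m) * a := hea.symm
    _ = (x * u) ^ m * x * (u * a) := by rw [add_comm, pow_succ]; simp only [mul_assoc]

/-- Dually: if `a = x (u a v) y` in a finite monoid then `a 𝓡 av`.
[cite: GanyushkinMazorchuk2009, Theorem 5.4.1 (proof)] -/
theorem greenR_mul_of_eq [Finite M] {a x u v y : M} (h : a = x * (u * a * v) * y) :
    (∃ p, a = (a * v) * p) ∧ ∃ q, a * v = a * q := by
  refine ⟨?_, ⟨v, rfl⟩⟩
  -- pass to the opposite monoid
  haveI : Finite Mᵐᵒᵖ := Finite.of_equiv M MulOpposite.opEquiv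
  have h' : (MulOpposite.op a) = MulOpposite.op y * (MulOpposite.op v * MulOpposite.op a *
      MulOpposite.op u) * MulOpposite.op x := by
    conv_lhs => rw [h]
    simp only [MulOpposite.op_mul, mul_assoc]
  obtain ⟨⟨p, hp⟩, -⟩ := greenL_mul_of_eq h'
  refine ⟨MulOpposite.unop p, ?_⟩
  have := congrArg MulOpposite.unop hp
  simpa [mul_assoc] using this

/-- Theorem 5.4.1: in a finite semigroup `𝓙 ⊆ 𝓓`: if `a = x b y` and `b = u a v` then
`a 𝓛 ua 𝓡 uav = b`. [cite: GanyushkinMazorchuk2009, Theorem 5.4.1] -/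
theorem greenD_of_greenJ [Finite M] {a b : M}
    (hJ : (∃ x y, a = x * b * y) ∧ ∃ u v, b = u * a * v) :
    ∃ c, ((∃ x, a = x * c) ∧ ∃ y, c = y * a) ∧ ((∃ x, c = b * x) ∧ ∃ y, b = c * y) := by
  obtain ⟨⟨x, y, hxy⟩, ⟨u, v, huv⟩⟩ := hJ
  have h : a = x * (u * a * v) * y := by rw [← huv]; exact hxy
  refine ⟨u * a, greenL_mul_of_eq h, ?_⟩
  -- `a 𝓡 av` hence `ua 𝓡 uav = b`
  have hR := greenR_mul_left (greenR_mul_of_eq h) u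
  -- hR : (∃ p, u * a = u * (a * v) * p) ∧ ∃ q, u * (a * v) = u * a * q
  obtain ⟨⟨p, hp⟩, ⟨q, hq⟩⟩ := hR
  refine ⟨⟨p, ?_⟩, ⟨q, ?_⟩⟩
  · calc u * a = u * (a * v) * p := hp
      _ = u * a * v * p := by simp only [mul_assoc]
      _ = b * p := by rw [huv]
  · calc b = u * a * v := huv
      _ = u * (a * v) := mul_assoc _ _ _
      _ = u * a * q := hq

/-- Theorem 5.4.1: in a finite semigroup `𝓓 = 𝓙`. [cite: GanyushkinMazorchuk2009, Theorem 5.4.1] -/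
theorem greenD_iff_greenJ [Finite M] (a b : M) :
    (∃ c, ((∃ x, a = x * c) ∧ ∃ y, c = y * a) ∧ ((∃ x, c = b * x) ∧ ∃ y, b = c * y)) ↔
      ((∃ x y, a = x * b * y) ∧ ∃ u v, b = u * a * v) := by
  refine ⟨?_, greenD_of_greenJ⟩
  rintro ⟨c, ⟨⟨x, hx⟩, ⟨y, hy⟩⟩, ⟨⟨s, hs⟩, ⟨t, ht⟩⟩⟩
  refine ⟨⟨x, s, by rw [hx, hs, mul_assoc]⟩, ⟨y, t, by rw [ht, hy]⟩⟩

/-! ### §6.4: primary conjugacy -/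

/-- Proposition 6.4.6 (i): if `x ∼ₚ y` (`x = ab`, `y = ba`) then `xⁱ ∼ₚ yⁱ` for all `i ≥ 1`:
`xⁱ = a · ((ba)ⁱ⁻¹ b)` and `yⁱ = ((ba)ⁱ⁻¹ b) · a`.
[cite: GanyushkinMazorchuk2009, Proposition 6.4.6 (i)] -/
theorem pow_primConj_pow {x y : M} (h : ∃ a b, x = a * b ∧ y = b * a) {i : ℕ} (hi : 1 ≤ i) :
    ∃ a b, x ^ i = a * b ∧ y ^ i = b * a := by
  obtain ⟨a, b, rfl, rfl⟩ := h
  obtain ⟨j, rfl⟩ := Nat.exists_eq_add_of_le hi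
  refine ⟨a, (b * a) ^ j * b, ?_, ?_⟩
  · -- (ab)^{1+j} = a (ba)^j b
    have key : ∀ n : ℕ, (a * b) ^ (n + 1) = a * ((b * a) ^ n * b) := by
      intro n
      induction n with
      | zero => simp
      | succ n ih =>
        rw [pow_succ, ih, pow_succ]
        simp only [mul_assoc]
    rw [add_comm]
    exact key j
  · rw [add_comm, pow_succ, mul_assoc]

/-- Proposition 6.4.6 (ii): if `e = xⁱ` and `f = yʲ` are idempotents (`i, j ≥ 1`) and `x ∼ₚ y`,
then `e ∼ₚ f` (`e = x^{ij}`, `f = y^{ij}`). [cite: GanyushkinMazorchuk2009, Proposition 6.4.6 (ii)] -/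
theorem primConj_of_pow_idempotent {x y : M} (h : ∃ a b, x = a * b ∧ y = b * a) {i j : ℕ}
    (hi : 1 ≤ i) (hj : 1 ≤ j) (he : IsIdempotentElem (x ^ i)) (hf : IsIdempotentElem (y ^ j)) :
    ∃ a b, x ^ i = a * b ∧ y ^ j = b * a := by
  have hx : x ^ i = x ^ (i * j) := by rw [pow_mul, he.pow_eq (by omega)]
  have hy : y ^ j = y ^ (i * j) := by rw [mul_comm, pow_mul, hf.pow_eq (by omega)]
  rw [hx, hy]
  exact pow_primConj_pow h (Nat.one_le_iff_ne_zero.2 (Nat.mul_ne_zero (by omega) (by omega)))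

/-- `∼ₚ` is reflexive on idempotents: `e = e · e`. [cite: GanyushkinMazorchuk2009, Corollary 6.4.8] -/
theorem primConj_idempotent_refl {e : M} (he : IsIdempotentElem e) :
    ∃ a b, e = a * b ∧ e = b * a :=
  ⟨e, e, he.eq.symm, he.eq.symm⟩

/-- `∼ₚ` is symmetric. [cite: GanyushkinMazorchuk2009, §6.4] -/
theorem primConj_symm {x y : M} (h : ∃ a b, x = a * b ∧ y = b * a) :
    ∃ a b, y = a * b ∧ x = b * a := by
  obtain ⟨a, b, hx, hy⟩ := h
  exact ⟨b, a, hy, hx⟩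

/-- Lemma 6.4.7: for idempotents `e, f, g`, `e ∼ₚ f` and `e ∼ₚ g` imply `f ∼ₚ g`
(`g = (vxf)(yug)`, `f = (yug)(vxf)` where `e = xy, f = yx, e = uv, g = vu`); hence
(Corollary 6.4.8) `∼ₚ` restricted to `E(S)` is an equivalence relation.
[cite: GanyushkinMazorchuk2009, Lemma 6.4.7] -/
theorem primConj_idempotent_trans {e f g : M} (he : IsIdempotentElem e) (hf : IsIdempotentElem f)
    (hg : IsIdempotentElem g) (hef : ∃ a b, e = a * b ∧ f = b * a)
    (heg : ∃ a b, e = a * b ∧ g = b * a) : ∃ a b, f = a * b ∧ g = b * a := by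
  obtain ⟨x, y, hexy, hfyx⟩ := hef
  obtain ⟨u, v, heuv, hgvu⟩ := heg
  -- e = x f y, f = y e x, e = u g v, g = v e u
  have he1 : e = x * f * y := by
    calc e = e * e := he.eq.symm
      _ = (x * y) * (x * y) := by rw [← hexy]
      _ = x * (y * x) * y := by simp only [mul_assoc]
      _ = x * f * y := by rw [← hfyx]
  have hf1 : f = y * e * x := by
    calc f = f * f := hf.eq.symm
      _ = (y * x) * (y * x) := by rw [← hfyx]
      _ = y * (x * y) * x := by simp only [mul_assoc]
      _ = y * e * x := by rw [← hexy]
  have he2 : e = u * g * v := by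
    calc e = e * e := he.eq.symm
      _ = (u * v) * (u * v) := by rw [← heuv]
      _ = u * (v * u) * v := by simp only [mul_assoc]
      _ = u * g * v := by rw [← hgvu]
  have hg1 : g = v * e * u := by
    calc g = g * g := hg.eq.symm
      _ = (v * u) * (v * u) := by rw [← hgvu]
      _ = v * (u * v) * u := by simp only [mul_assoc]
      _ = v * e * u := by rw [← heuv]
  -- g = v x f y u, f = y u g v x
  have hg2 : g = (v * x * f) * (y * u * g) := by
    calc g = g * g := hg.eq.symm
      _ = (v * e * u) * g := by rw [← hg1]
      _ = (v * (x * f * y) * u) * g := by rw [← he1]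
      _ = (v * x * f) * (y * u * g) := by simp only [mul_assoc]
  have hf2 : f = (y * u * g) * (v * x * f) := by
    calc f = f * f := hf.eq.symm
      _ = (y * e * x) * f := by rw [← hf1]
      _ = (y * (u * g * v) * x) * f := by rw [← he2]
      _ = (y * u * g) * (v * x * f) := by simp only [mul_assoc]
  exact ⟨y * u * g, v * x * f, hf2, hg2⟩

/-- Corollary 6.4.11: for idempotents `e, f` of a finite semigroup, `e ∼ₚ f` iff `e 𝓓 f`
(`⇒`: `e = ufv`, `f = veu` give `e 𝓙 f`, and `𝓙 = 𝓓` by Theorem 5.4.1; `⇐`: Theorem 4.7.5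
provides `a, a'` with `e = aa'`, `f = a'a`). [cite: GanyushkinMazorchuk2009, Corollary 6.4.11] -/
theorem primConj_idempotent_iff_greenD [Finite M] {e f : M} (he : IsIdempotentElem e)
    (hf : IsIdempotentElem f) :
    (∃ a b, e = a * b ∧ f = b * a) ↔
      ∃ c, ((∃ x, e = x * c) ∧ ∃ y, c = y * e) ∧ ((∃ x, c = f * x) ∧ ∃ y, f = c * y) := by
  constructor
  · rintro ⟨u, v, heuv, hfvu⟩
    apply greenD_of_greenJ
    refine ⟨⟨u, v, ?_⟩, ⟨v, u, ?_⟩⟩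
    · calc e = e * e := he.eq.symm
        _ = (u * v) * (u * v) := by rw [← heuv]
        _ = u * (v * u) * v := by simp only [mul_assoc]
        _ = u * f * v := by rw [← hfvu]
    · calc f = f * f := hf.eq.symm
        _ = (v * u) * (v * u) := by rw [← hfvu]
        _ = v * (u * v) * u := by simp only [mul_assoc]
        _ = v * e * u := by rw [← heuv]
  · intro hD
    obtain ⟨a, a', h1, h2, -⟩ := exists_bijOn_mulHom_greenH_of_greenD he.eq hf.eq hD
    exact ⟨a, a', h1.symm, h2.symm⟩

end Literature.Algebra.Semigroups
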